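import Literature.AnabelianGeometry.SemiGraphs.Coverticial
import Literature.AnabelianGeometry.SemiGraphs.PiPresentationBridge
import Literature.AnabelianGeometry.Anabelioids.BCatBranchConjugacy
import Literature.AnabelianGeometry.SemiGraphs.ProSigmaCompletionTransport
import Literature.AnabelianGeometry.SemiGraphs.ProSigmaCompletionModels
import Literature.AnabelianGeometry.SemiGraphs.SubdivisionLemmas
import HarnessLib

/-!
# Models of "semi-graph of anabelioids of surface type" ([SemiAnbd] Example 2.10, smooth case)

Mochizuki, *Semi-graphs of anabelioids*, Publ. RIMS **42** (2006) 221–322, Example 2.10 p. 31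
[cite: MochizukiSemiAnbd2006, Ex. 2.10 p.31].  The tree's interface
`SemiGraphOfAnabelioids.IsOfSurfaceType Σ` (`Coverticial.lean`: every `Π_v` a pro-`Σ` completion of a
hyperbolic punctured surface group `Γ_{g,r}`, every `Π_b → Π_v` the inclusion of the closed inertia
subgroup of one of the cusps, distinct branches at `v` ↦ distinct cusps) is the HYPOTHESIS of some
twenty landed files (Ex. 2.10 conjuncts, Cor. 2.7 (i) for surface type, cusp quotients, …) and had no
inhabitant in the tree.  This proof-only file supplies:

* `ProfiniteSemiGraph.isOfSurfaceType_toAnab` — the BRIDGE from the profinite-group presentation: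
  if the vertex groups `Π_v` of a semi-graph of profinite groups `𝔊` (of injective type) carry
  pro-`Σ` completions `ι_v : Γ_{g_v,r_v} → Π_v` of hyperbolic type and each branch subgroup
  `b_*(Π_e) ⊆ Π_v` is a `Π_v`-conjugate of the closure of `ι_v` of the inertia group of the cusp
  `js_v(b)`, `js_v` injective on the branches at `v`, then `{B(Π_v), B(Π_e), B(b_*)}` is of surface
  type at EVERY basepoint (engine: `Anabelioids.exists_continuousMulEquiv_forall_range_conj`,
  "`Π_b ⊆ Π_v` is well-defined up to conjugation", and a re-choice of the transport isomorphism by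
  an inner automorphism);
* `ProfiniteSemiGraph.exists_isOfSurfaceType` / `SemiGraphOfAnabelioids.exists_isOfSurfaceType` —
  the MODEL: for every nonempty set of primes `Σ` and every hyperbolic `(g, r)`, the semi-graph of
  anabelioids of a smooth `r`-pointed curve of genus `g` in the sense of Example 2.10 — one vertex
  `v` with `𝒢_v = B(P)`, `P` a pro-`Σ` completion of `Γ_{g,r}`
  (`IsProSigmaCompletion.exists_isProSigmaCompletion`), and `r` open edges (the cusps) `e_j` with
  `𝒢_{e_j} = B(Ī_j)`, `Ī_j ⊆ P` the closure of the image of the `j`-th cusp inertia group — is of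
  surface type, connected, every edge abutting to the vertex.

A model certifies that the hypothesis is satisfiable (non-vacuity); nothing here takes a side on
[IUTchIII] Cor. 3.12.  Theorems only.
-/

noncomputable section

namespace Literature.AnabelianGeometry.SemiGraphs

open CategoryTheory CategoryTheory.Limits CategoryTheory.PreGaloisCategory
open Literature.AnabelianGeometry.Anabelioids
open Literature.AlgebraicGeometry.Frobenioids (BCat)
open Literature.GroupTheory.CombinatorialGroupTheory
open scoped Pointwise Topology FintypeCatDiscrete

universe u

namespace ProfiniteSemiGraph

variable (𝔊 : ProfiniteSemiGraph.{u})

/-- Conjugating a subgroup and then mapping it along a group isomorphism is mapping it and then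
conjugating by the image of the conjugator. [folklore] -/
private theorem map_toConjAct_smul_mulEquiv {A B : Type*} [Group A] [Group B] (e : A ≃* B) (a : A)
    (K : Subgroup A) :
    (ConjAct.toConjAct a • K).map e.toMonoidHom = ConjAct.toConjAct (e a) • K.map e.toMonoidHom := by
  ext y
  simp only [Subgroup.mem_map, Subgroup.mem_smul_pointwise_iff_exists, MulEquiv.coe_toMonoidHom,
    ConjAct.smul_def, ConjAct.ofConjAct_toConjAct]
  constructor
  · rintro ⟨_, ⟨k, hk, rfl⟩, rfl⟩
    exact ⟨e k, ⟨k, hk, rfl⟩, by simp⟩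
  · rintro ⟨_, ⟨k, hk, rfl⟩, rfl⟩
    exact ⟨a * k * a⁻¹, ⟨k, hk, rfl⟩, by simp⟩

/-- **Bridge: semi-graphs of profinite groups of surface type give semi-graphs of anabelioids of
surface type** ([SemiAnbd] Ex. 2.10 p. 31, "each `Π_v` is the maximal pro-`Σ` quotient of the
fundamental group of a hyperbolic Riemann surface of finite type … each `Π_b → Π_v` is the inclusion
morphism of the inertia group of one of the cusps").  Hypotheses, per vertex `v`: a pro-`Σ` completion
`ι : Γ_{g,r} → Π_v` of hyperbolic type, an injective assignment `js` of cusps to the branches at `v`,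
and for each such branch `b` an element `x ∈ Π_v` with `b_*(Π_e) = x · closure(ι(⟨c_{js b}⟩)) · x⁻¹`;
conclusion: `𝔊.toAnab = {B(Π_v), B(Π_e), B(b_*)}` is of surface type (at every basepoint `F` of
`B(Π_v)`: transport along `θ : Aut F ≃ₜ* Π_v` of `BCatBranchConjugacy`).
[cite: MochizukiSemiAnbd2006, Ex. 2.10 p.31] -/
theorem isOfSurfaceType_toAnab (Sigma : Set ℕ) (hSigma : Sigma.Nonempty ∧ ∀ p ∈ Sigma, p.Prime)
    (hinj : 𝔊.IsOfInjectiveType)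
    (hv : ∀ v : 𝔊.graph.Vertex, ∃ (g r : ℕ) (ι : PuncturedSurfaceGroup g r →* 𝔊.Gv v),
      PuncturedSurfaceGroup.IsHyperbolicType g r ∧
        SemiGraphOfAnabelioids.IsProSigmaCompletion Sigma ι ∧
        ∃ js : 𝔊.graph.Star v → Fin r, Function.Injective js ∧
          ∀ b : 𝔊.graph.Star v, ∃ x : 𝔊.Gv v,
            𝔊.branchSubgroup b.1 v b.2 =
              ConjAct.toConjAct x •
                ((PuncturedSurfaceGroup.cuspInertia (g := g) (js b)).map ι).topologicalClosure) :
    𝔊.toAnab.IsOfSurfaceType Sigma := by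
  refine ⟨hSigma, (𝔊.isOfInjectiveType_toAnab_iff).mpr hinj, ?_⟩
  intro v F hF
  obtain ⟨g, r, ι, hgr, hι, js, hjs, hbr⟩ := hv v
  obtain ⟨θ₀, hθ⟩ := @exists_continuousMulEquiv_forall_range_conj (𝔊.Gv v) _ _
    (𝔊.isTopologicalGroupV v) (𝔊.compactSpaceV v) (𝔊.totallyDisconnectedSpaceV v) F hF
  -- the same identification, typed over the constituent anabelioid `𝔊.toAnab.V v = B(Π_v)`
  let θ : 𝔊.toAnab.PiV v F ≃ₜ* 𝔊.Gv v := θ₀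
  refine ⟨g, r, θ.symm.toMulEquiv.toMonoidHom.comp ι, hgr, hι.comp_continuousMulEquiv θ.symm, js,
    hjs, ?_⟩
  intro b Fe hFe
  -- some transport `α₀ : b^* ⋙ F_e ≅ F` (both are basepoints of `B(Π_v)`; `b^* ⋙ forget = forget`)
  obtain ⟨lam⟩ := @nonempty_iso_of_fiberFunctor _ _ _ Fe
    (ObjectProperty.ι (Action.IsContinuous (V := FintypeCat.{u})
      (G := 𝔊.Ge (𝔊.graph.edgeOf b.1))) ⋙ Action.forget FintypeCat.{u} _)
    hFe (fiberFunctor_forget_bCat (𝔊.Ge (𝔊.graph.edgeOf b.1)))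
  obtain ⟨κ⟩ := @nonempty_iso_of_fiberFunctor _ _ _ F
    (ObjectProperty.ι (Action.IsContinuous (V := FintypeCat.{u}) (G := 𝔊.Gv v)) ⋙
      Action.forget FintypeCat.{u} _)
    hF (fiberFunctor_forget_bCat (𝔊.Gv v))
  let α₀ : (𝔊.toAnab.pull b.1 v b.2).pullback ⋙ Fe ≅ F :=
    Functor.isoWhiskerLeft (ContAction.res FintypeCat.{u} (𝔊.brHom b.1 v b.2)) lam ≪≫ κ.symm
  -- the branch subgroup for `α₀` is carried by `θ` to `x · b_*(Π_e) · x⁻¹ = (x y) · K · (x y)⁻¹`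
  obtain ⟨x, hx⟩ := hθ (𝔊.Ge (𝔊.graph.edgeOf b.1)) (𝔊.brHom b.1 v b.2) Fe hFe α₀
  obtain ⟨y, hy⟩ := hbr b
  set K : Subgroup (𝔊.Gv v) :=
    ((PuncturedSurfaceGroup.cuspInertia (g := g) (js b)).map ι).topologicalClosure with hK
  have h1 : (𝔊.toAnab.branchSubgroup F b.1 b.2 Fe α₀).map θ.toMulEquiv.toMonoidHom =
      ConjAct.toConjAct (x * y) • K := by
    rw [map_mul, mul_smul, ← hy]
    exact hx
  -- re-choose the transport: `α := α₀ ≫ τ` with `τ := θ⁻¹((x y)⁻¹)`, which conjugates the branch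
  -- subgroup by `τ` ([SemiAnbd] Def. 2.1: "well-defined up to conjugation")
  let τ : 𝔊.toAnab.PiV v F := θ.symm (x * y)⁻¹
  let α : (𝔊.toAnab.pull b.1 v b.2).pullback ⋙ Fe ≅ F := α₀ ≪≫ τ
  have hτ : SemiGraphOfAnabelioids.transportAut α₀ α = τ := by
    change α₀.symm ≪≫ (α₀ ≪≫ τ) = τ
    rw [Iso.symm_self_id_assoc]
  have h2 : (𝔊.toAnab.branchSubgroup F b.1 b.2 Fe α).map θ.toMulEquiv.toMonoidHom = K := by
    rw [SemiGraphOfAnabelioids.branchSubgroup_eq_conjAct_smul 𝔊.toAnab F b.1 b.2 Fe α₀ α, hτ,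
      map_toConjAct_smul_mulEquiv, h1, ← mul_smul, ← map_mul]
    have : θ.toMulEquiv τ * (x * y) = 1 := by
      change θ (θ.symm (x * y)⁻¹) * (x * y) = 1
      rw [ContinuousMulEquiv.apply_symm_apply, inv_mul_cancel]
    rw [this, map_one, one_smul]
  refine ⟨α, ?_⟩
  -- pass to subsets of `Aut F` and `Π_v`
  have h3 : (𝔊.toAnab.branchSubgroup F b.1 b.2 Fe α : Set (𝔊.toAnab.PiV v F)) =
      θ.symm '' (K : Set (𝔊.Gv v)) := by
    have h3' := congrArg (fun S : Subgroup (𝔊.Gv v) => (S : Set (𝔊.Gv v))) h2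
    simp only [Subgroup.coe_map, MulEquiv.coe_toMonoidHom] at h3'
    rw [← h3', ← Set.image_comp]
    ext s
    constructor
    · exact fun hs => ⟨s, hs, θ.symm_apply_apply s⟩
    · rintro ⟨t, ht, rfl⟩
      convert ht using 1
      exact θ.symm_apply_apply t
  rw [h3, hK, Subgroup.topologicalClosure_coe, Subgroup.coe_map]
  change θ.symm.toHomeomorph '' _ = _
  rw [θ.symm.toHomeomorph.image_closure, Set.image_image]
  rfl

/-! ### Two elementary facts about semi-graphs -/

/-- A semi-graph with a vertex `v₀`, no other vertex, and every edge abutting to `v₀` is connected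
(every point of the subdivision is within distance `3` of the vertex-point).
[cite: MochizukiSemiAnbd2006, §1 pp.11-13] -/
theorem _root_.Literature.AnabelianGeometry.SemiGraphs.SemiGraph.isConnected_of_forall_edgeAbuts
    (G : SemiGraph.{u}) (v₀ : G.Vertex) (hV : ∀ v : G.Vertex, v = v₀)
    (hE : ∀ e : G.Edge, G.EdgeAbuts e v₀) : G.IsConnected := by
  -- every node is reachable from the vertex-point `v₀`
  have hbr : ∀ b : G.Branch, G.abuts b = some v₀ →
      G.subdivision.Reachable (Sum.inl v₀) (Sum.inr (Sum.inr b)) := fun b hb =>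
    (G.subdivision_adj_of_nodeRel (SemiGraph.NodeRel.branch_vertex b v₀ hb)).reachable.symm
  have hed : ∀ e : G.Edge, G.subdivision.Reachable (Sum.inl v₀) (Sum.inr (Sum.inl e)) := by
    intro e
    obtain ⟨b, hbe, hb⟩ := hE e
    refine (hbr b hb).trans ?_
    rw [← hbe]
    exact (G.subdivision_adj_of_nodeRel (SemiGraph.NodeRel.edge_branch b)).reachable.symm
  have hall : ∀ x : G.Node, G.subdivision.Reachable (Sum.inl v₀) x := by
    rintro (v | e | b)
    · rw [hV v]
    · exact hed e
    · exact (hed (G.edgeOf b)).trans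
        (G.subdivision_adj_of_nodeRel (SemiGraph.NodeRel.edge_branch b)).reachable
  haveI : Nonempty G.Node := ⟨Sum.inl v₀⟩
  exact ⟨⟨fun x y => (hall x).symm.trans (hall y)⟩⟩

/-- An edge with at most one abutting branch is open (verticial cardinality `< 2`).
[cite: MochizukiSemiAnbd2006, §1 p.12] -/
theorem _root_.Literature.AnabelianGeometry.SemiGraphs.SemiGraph.isOpenEdge_of_subsingleton
    (G : SemiGraph.{u}) (e : G.Edge) (b₀ : G.Branch)
    (h : ∀ b : G.Branch, G.edgeOf b = e → (G.abuts b).isSome = true → b = b₀) :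
    G.IsOpenEdge e := by
  have hsub : G.verticialPortion e ⊆ {b₀} := fun b hb => by
    rw [Set.mem_singleton_iff]
    exact h b hb.1 hb.2
  calc G.vertCard e = (G.verticialPortion e).ncard := rfl
    _ ≤ ({b₀} : Set G.Branch).ncard := Set.ncard_le_ncard hsub (Set.toFinite _)
    _ = 1 := Set.ncard_singleton b₀
    _ < 2 := by norm_num

/-! ### The model: the semi-graph of anabelioids of a smooth pointed curve -/

/-- The model over a GIVEN pro-`Σ` completion `ι : Γ_{g,r} → P` (profinite `P`): the semi-graph of
profinite groups with one vertex `v` (`Π_v = P`), `r` open edges `e_j` (`Π_{e_j} = Ī_j`, the closure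
of `ι(⟨c_j⟩)`, included into `P` along the unique abutting branch of `e_j`) — the dual semi-graph
of a smooth `r`-pointed curve of genus `g` with its cusps as open edges ([SemiAnbd] Ex. 2.10 p. 31)
— is of injective type, connected, every edge abuts to the vertex, and its semi-graph of
anabelioids `{B(Π_v), B(Π_e), B(b_*)}` is of surface type. [cite: MochizukiSemiAnbd2006, Ex. 2.10 p.31] -/
theorem exists_isOfSurfaceType_of_isProSigmaCompletion (Sigma : Set ℕ)
    (hSigma : Sigma.Nonempty ∧ ∀ p ∈ Sigma, p.Prime) (g r : ℕ)
    (hgr : PuncturedSurfaceGroup.IsHyperbolicType g r) (P : Type) [Group P] [TopologicalSpace P]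
    [IsTopologicalGroup P] [CompactSpace P] [TotallyDisconnectedSpace P]
    (ι : PuncturedSurfaceGroup g r →* P) (hι : SemiGraphOfAnabelioids.IsProSigmaCompletion Sigma ι) :
    ∃ 𝔊 : ProfiniteSemiGraph.{0},
      Nonempty (𝔊.graph.Vertex ≃ Unit) ∧ Nonempty (𝔊.graph.Edge ≃ Fin r) ∧
        (∀ e, 𝔊.graph.IsOpenEdge e) ∧ 𝔊.toAnab.EveryEdgeAbuts ∧ 𝔊.toAnab.IsConnected ∧
        𝔊.IsOfInjectiveType ∧
        (∀ v, Nonempty (𝔊.Gv v ≃ₜ* P) ∧ ∃ ιv : PuncturedSurfaceGroup g r →* 𝔊.Gv v,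
          SemiGraphOfAnabelioids.IsProSigmaCompletion Sigma ιv ∧
            ∃ js : 𝔊.graph.Star v ≃ Fin r, ∀ b : 𝔊.graph.Star v,
              𝔊.branchSubgroup b.1 v b.2 =
                ((PuncturedSurfaceGroup.cuspInertia (g := g) (js b)).map ιv).topologicalClosure) ∧
        𝔊.toAnab.IsOfSurfaceType Sigma := by
  -- the closed cusp-inertia subgroups `Ī_j ⊆ P` are compact
  haveI hKc : ∀ j : Fin r, CompactSpace
      ↥(((PuncturedSurfaceGroup.cuspInertia (g := g) j).map ι).topologicalClosure) := fun j =>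
    isCompact_iff_compactSpace.mp (Subgroup.isClosed_topologicalClosure _).isCompact
  -- the model
  let 𝔊 : ProfiniteSemiGraph.{0} :=
    { graph :=
        { Vertex := Unit
          Edge := Fin r
          Branch := Fin r ⊕ Fin r
          edgeOf := Sum.elim id id
          abuts := Sum.elim (fun _ => some ()) (fun _ => none)
          two_branches := fun e => ⟨Sum.inl e, Sum.inr e, Sum.inl_ne_inr, rfl, rfl, fun b hb => by
            rcases b with j | j
            · left; exact congrArg Sum.inl hb
            · right; exact congrArg Sum.inr hb⟩ }
      Gv := fun _ => P
      Ge := fun j => ↥(((PuncturedSurfaceGroup.cuspInertia (g := g) j).map ι).topologicalClosure)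
      brHom := fun b _ _ =>
        { (((PuncturedSurfaceGroup.cuspInertia (g := g) (Sum.elim id id b)).map ι)
              |>.topologicalClosure).subtype with
          continuous_toFun := continuous_subtype_val } }
  have hbranch : ∀ (b : 𝔊.graph.Branch) (v : 𝔊.graph.Vertex), 𝔊.graph.abuts b = some v →
      ∃ j : Fin r, b = Sum.inl j := by
    rintro (j | j) v hb
    · exact ⟨j, rfl⟩
    · exact absurd hb (by simp [𝔊])
  -- the cusp of a branch at the vertex
  let js : ∀ v : 𝔊.graph.Vertex, 𝔊.graph.Star v ≃ Fin r := fun v =>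
    { toFun := fun b => Sum.elim id id b.1
      invFun := fun j => ⟨Sum.inl j, rfl⟩
      left_inv := fun b => by
        obtain ⟨j, hj⟩ := hbranch b.1 v b.2
        apply Subtype.ext
        simp [hj]
      right_inv := fun j => rfl }
  have hbs : ∀ (v : 𝔊.graph.Vertex) (b : 𝔊.graph.Star v),
      𝔊.branchSubgroup b.1 v b.2 =
        ((PuncturedSurfaceGroup.cuspInertia (g := g) (js v b)).map ι).topologicalClosure :=
    fun v b => Subgroup.range_subtype _
  refine ⟨𝔊, ⟨Equiv.refl _⟩, ⟨Equiv.refl _⟩, ?_, ?_, ?_, ?_, ?_, ?_⟩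
  · -- every edge is open: only the branch `inl j` of `e_j` abuts
    intro e
    refine 𝔊.graph.isOpenEdge_of_subsingleton e (Sum.inl e) fun b hb hbs' => ?_
    rcases b with j | j
    · exact congrArg Sum.inl hb
    · simp [𝔊] at hbs'
  · -- every edge abuts to the vertex
    exact fun e => ⟨Sum.inl e, (), rfl, rfl⟩
  · -- connected
    exact ⟨𝔊.graph.isConnected_of_forall_edgeAbuts () (fun _ => rfl) fun e => ⟨Sum.inl e, rfl, rfl⟩⟩
  · -- of injective type: the `b_*` are subgroup inclusions
    exact fun b v h => Subtype.val_injective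
  · -- the vertex groups and branch groups
    intro v
    exact ⟨⟨ContinuousMulEquiv.refl P⟩, ι, hι, js v, hbs v⟩
  · -- of surface type, by the bridge
    refine 𝔊.isOfSurfaceType_toAnab Sigma hSigma (fun b v h => Subtype.val_injective) fun v =>
      ⟨g, r, ι, hgr, hι, js v, (js v).injective, fun b => ⟨1, ?_⟩⟩
    rw [map_one, one_smul]
    exact hbs v b

/-- **Example 2.10 has a model (non-vacuity of `IsOfSurfaceType`)**: for every nonempty set of
primes `Σ` and every hyperbolic type `(g, r)` there is a semi-graph of profinite groups — one vertex
with vertex group a pro-`Σ` completion of `Γ_{g,r}`, `r` open edges whose groups are the closed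
cusp-inertia subgroups, one per cusp — which is of injective type, connected, with every edge
abutting to the vertex, and whose semi-graph of anabelioids is of surface type
(`IsProSigmaCompletion.exists_isProSigmaCompletion` + `exists_isOfSurfaceType_of_isProSigmaCompletion`).
[cite: MochizukiSemiAnbd2006, Ex. 2.10 p.31] -/
theorem exists_isOfSurfaceType (Sigma : Set ℕ) (hSigma : Sigma.Nonempty ∧ ∀ p ∈ Sigma, p.Prime)
    (g r : ℕ) (hgr : PuncturedSurfaceGroup.IsHyperbolicType g r) :
    ∃ 𝔊 : ProfiniteSemiGraph.{0},
      Nonempty (𝔊.graph.Vertex ≃ Unit) ∧ Nonempty (𝔊.graph.Edge ≃ Fin r) ∧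
        (∀ e, 𝔊.graph.IsOpenEdge e) ∧ 𝔊.toAnab.EveryEdgeAbuts ∧ 𝔊.toAnab.IsConnected ∧
        𝔊.IsOfInjectiveType ∧
        (∀ v, ∃ ιv : PuncturedSurfaceGroup g r →* 𝔊.Gv v,
          SemiGraphOfAnabelioids.IsProSigmaCompletion Sigma ιv ∧
            ∃ js : 𝔊.graph.Star v ≃ Fin r, ∀ b : 𝔊.graph.Star v,
              𝔊.branchSubgroup b.1 v b.2 =
                ((PuncturedSurfaceGroup.cuspInertia (g := g) (js b)).map ιv).topologicalClosure) ∧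
        𝔊.toAnab.IsOfSurfaceType Sigma := by
  obtain ⟨P, ι, hι⟩ := SemiGraphOfAnabelioids.IsProSigmaCompletion.exists_isProSigmaCompletion
    (PuncturedSurfaceGroup g r) Sigma
  obtain ⟨𝔊, h1, h2, h3, h4, h5, h6, h7, h8⟩ :=
    exists_isOfSurfaceType_of_isProSigmaCompletion Sigma hSigma g r hgr P ι hι
  exact ⟨𝔊, h1, h2, h3, h4, h5, h6, fun v => (h7 v).2, h8⟩

end ProfiniteSemiGraph

/-- **`IsOfSurfaceType` is inhabited** (in the category-of-anabelioids presentation of §2): for every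
nonempty set of primes `Σ` and hyperbolic `(g, r)` there is a connected semi-graph of anabelioids of
surface type with exactly one vertex and `r` edges, all open and abutting to the vertex — the
semi-graph of anabelioids of a smooth `r`-pointed curve of genus `g` ([SemiAnbd] Ex. 2.10 p. 31).
[cite: MochizukiSemiAnbd2006, Ex. 2.10 p.31] -/
theorem SemiGraphOfAnabelioids.exists_isOfSurfaceType (Sigma : Set ℕ)
    (hSigma : Sigma.Nonempty ∧ ∀ p ∈ Sigma, p.Prime) (g r : ℕ)
    (hgr : PuncturedSurfaceGroup.IsHyperbolicType g r) :
    ∃ 𝒢 : SemiGraphOfAnabelioids.{0, 1, 0},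
      𝒢.IsOfSurfaceType Sigma ∧ 𝒢.EveryEdgeAbuts ∧ 𝒢.IsConnected ∧
        Nonempty (𝒢.graph.Vertex ≃ Unit) ∧ Nonempty (𝒢.graph.Edge ≃ Fin r) ∧
        ∀ e, 𝒢.graph.IsOpenEdge e := by
  obtain ⟨𝔊, h1, h2, h3, h4, h5, -, -, h8⟩ :=
    ProfiniteSemiGraph.exists_isOfSurfaceType Sigma hSigma g r hgr
  exact ⟨𝔊.toAnab, h8, h4, h5, h1, h2, h3⟩


end Literature.AnabelianGeometry.SemiGraphs

end
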